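import Mathlib
import Summits.Parity.BatemanHorn.Theorems.IsogenyRedeiSplitBlockJacobiWeylCorner
import HarnessLib

/-!
# The corner implication with the REPAIRED (aspect-bounded) bilinear hypothesis

Crux `IsogenyRedei.SplitBlockJacobi` (stmt-Parity-11583), line `cofactor-root-discrepancy`, support for the
Weyl layer.  The landed corner implication `tierWeylBound_of_mixedBilinear` (this directory, `…WeylCorner`)
takes as hypothesis a bilinear power saving `‖T_h‖ ≤ (P₁P₂)^{1−δ₀}` over ALL dyadic-type boxes `P₁ ≤ P₂`,
with no bound on the aspect ratio; the crux's disprover (drefute g2, `Cruxes/SplitBlockJacobi/DrefuteG2.lean`,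
`row_of_mixedBilinear`) observed that this hypothesis then contains single rows `P₁' = P₁ + 1 = Q₀` with
`P₂ → ∞`, i.e. a power-saving Legendre-twisted Duke–Friedlander–Iwaniec prime sum, an open problem the corner
never needs.  Here we prove the implication from the REPAIRED hypothesis `MixedBilinearBalanced δ₀` carrying
the aspect bound `P₂ ≤ 8·P₁^{1+δ₀}`: in the corner (`x^θ ≤ 2P₁`, `θ > 1/2`, `P₁P₂ ≤ x^{2−μ} ≤ x^{1+δ₀/3}`)
one has `x ≤ (2P₁)²`, hence `P₂ ≤ 2^{2+2δ₀/3}·P₁^{1+2δ₀/3} ≤ 8·P₁^{1+δ₀}` (`aspect_of_corner`), so the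
balanced hypothesis suffices verbatim.  All skeleton definitions (`rootWeylSum`, `twistedSum`,
`TierWeylBound`) are expanded; nothing is posited.
-/

noncomputable section

namespace Summit.Parity.BatemanHorn.Cruxes.SplitBlockJacobi.CofactorRootDiscrepancy

namespace Weyl

/-- **Aspect ratio in the corner.** If `1 ≤ x`, `1 ≤ P₁`, `x^θ ≤ 2P₁` with `1/2 < θ`, and
`P₁·P₂ ≤ x^{2−μ}` with `1 − δ₀/3 ≤ μ`, `0 < δ₀ ≤ 1`, then `P₂ ≤ 8·P₁^{1+δ₀}`. [folklore] -/
theorem aspect_of_corner {δ₀ θ μ x p P : ℝ} (hδ₀ : 0 < δ₀) (hδ₁ : δ₀ ≤ 1) (hθ : 1 / 2 < θ)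
    (hμ : 1 - δ₀ / 3 ≤ μ) (hx : 1 ≤ x) (hp1 : 1 ≤ p) (hxP : x ^ θ ≤ 2 * p)
    (hN : p * P ≤ x ^ (2 - μ)) : P ≤ 8 * p ^ (1 + δ₀) := by
  have hx0 : 0 < x := one_pos.trans_le hx
  have hp0 : 0 < p := one_pos.trans_le hp1
  -- `x ≤ (2p)²`
  have h1 : x ≤ (2 * p) ^ (2 : ℕ) := by
    have hx2θ : x ≤ x ^ (2 * θ) := by
      calc x = x ^ (1 : ℝ) := (Real.rpow_one x).symm
        _ ≤ x ^ (2 * θ) := Real.rpow_le_rpow_of_exponent_le hx (by linarith)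
    have hsq : x ^ (2 * θ) = (x ^ θ) ^ (2 : ℕ) := by
      rw [mul_comm, Real.rpow_mul hx0.le, Real.rpow_two]
    rw [hsq] at hx2θ
    exact hx2θ.trans (pow_le_pow_left₀ (by positivity) hxP 2)
  -- `pP ≤ x^{1+δ₀/3} ≤ (2p)^{2+2δ₀/3}`
  have h2 : p * P ≤ x ^ (1 + δ₀ / 3) :=
    hN.trans (Real.rpow_le_rpow_of_exponent_le hx (by linarith))
  have hpos23 : 0 ≤ 1 + δ₀ / 3 := by linarith
  have h3 : x ^ (1 + δ₀ / 3) ≤ (2 * p) ^ (2 + 2 * δ₀ / 3) := by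
    calc x ^ (1 + δ₀ / 3) ≤ ((2 * p) ^ (2 : ℕ)) ^ (1 + δ₀ / 3) :=
          Real.rpow_le_rpow hx0.le h1 hpos23
      _ = (2 * p) ^ (2 + 2 * δ₀ / 3) := by
          rw [← Real.rpow_natCast, ← Real.rpow_mul (by positivity)]
          norm_num
          ring_nf
  -- `(2p)^{2+2δ₀/3} = 2^{2+2δ₀/3} p^{2+2δ₀/3} ≤ 8 · p · p^{1+δ₀}`
  have h4 : (2 * p) ^ (2 + 2 * δ₀ / 3) ≤ 8 * (p * p ^ (1 + δ₀)) := by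
    rw [Real.mul_rpow (by norm_num) hp0.le]
    have h2pow : (2 : ℝ) ^ (2 + 2 * δ₀ / 3) ≤ 8 := by
      calc (2 : ℝ) ^ (2 + 2 * δ₀ / 3) ≤ (2 : ℝ) ^ (3 : ℝ) :=
            Real.rpow_le_rpow_of_exponent_le one_le_two (by linarith)
        _ = 8 := by norm_num
    have hppow : p ^ (2 + 2 * δ₀ / 3) ≤ p * p ^ (1 + δ₀) := by
      calc p ^ (2 + 2 * δ₀ / 3) ≤ p ^ (2 + δ₀) :=
            Real.rpow_le_rpow_of_exponent_le hp1 (by linarith)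
        _ = p * p ^ (1 + δ₀) := by
            rw [show (2 : ℝ) + δ₀ = 1 + (1 + δ₀) by ring, Real.rpow_add hp0, Real.rpow_one]
    have hp2 : 0 ≤ p ^ (2 + 2 * δ₀ / 3) := by positivity
    calc (2 : ℝ) ^ (2 + 2 * δ₀ / 3) * p ^ (2 + 2 * δ₀ / 3) ≤ 8 * p ^ (2 + 2 * δ₀ / 3) :=
          mul_le_mul_of_nonneg_right h2pow hp2
      _ ≤ 8 * (p * p ^ (1 + δ₀)) := mul_le_mul_of_nonneg_left hppow (by norm_num)
  have hmain : p * P ≤ p * (8 * p ^ (1 + δ₀)) := by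
    calc p * P ≤ 8 * (p * p ^ (1 + δ₀)) := h2.trans (h3.trans h4)
      _ = p * (8 * p ^ (1 + δ₀)) := by ring
  exact le_of_mul_le_mul_left hmain hp0

end Weyl

/-- **Corner implication from the BALANCED bilinear hypothesis** (drefute g2's repair of the corner
milestone): if for some `P₀` every dyadic-type box of primes `≡ 1 (mod 4)` with `P₀ ≤ P₁ ≤ P₂ ≤ 8P₁^{1+δ₀}`
satisfies `‖T_h‖ ≤ (P₁P₂)^{1−δ₀}` for all `0 < |h| ≤ (P₁P₂)^{δ₀}`, then `TierWeylBound θ μ` holds for every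
`1/2 < θ < 1` and `1 − δ₀/3 ≤ μ < 1` (with `ε₀ = δ₀/3`).  The aspect bound is automatic in the corner
(`Weyl.aspect_of_corner`), so the proof is the one of `tierWeylBound_of_mixedBilinear` with that bound supplied.
[folklore] -/
theorem tierWeylBound_of_mixedBilinearBalanced :
    ∀ {δ₀ : ℝ}, 0 < δ₀ → δ₀ ≤ 1 →
      (∃ P₀ : ℕ, ∀ P₁ P₁' P₂ P₂' : ℕ, P₀ ≤ P₁ → P₁ ≤ P₁' → P₁' ≤ 2 * P₁ → P₁ ≤ P₂ →
        P₂ ≤ P₂' → P₂' ≤ 2 * P₂ → (P₂ : ℝ) ≤ 8 * (P₁ : ℝ) ^ (1 + δ₀) →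
          ∀ h : ℤ, h ≠ 0 → (|h| : ℝ) ≤ ((P₁ * P₂ : ℕ) : ℝ) ^ δ₀ →
          ‖∑ Q ∈ (Finset.Ioc P₁ P₁').filter (fun Q : ℕ => Q.Prime ∧ Q % 4 = 1),
              ∑ Q' ∈ (Finset.Ioc P₂ P₂').filter (fun Q' : ℕ => Q'.Prime ∧ Q' % 4 = 1),
                (jacobiSym (Q : ℤ) Q' : ℂ) *
                  ∑ ν ∈ (Finset.range (Q * Q')).filter (fun ν : ℕ => Q * Q' ∣ ν ^ 2 + 1),
                    Complex.exp (2 * Real.pi * Complex.I * (h : ℂ) * (ν : ℂ) /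
                      ((Q * Q' : ℕ) : ℂ))‖ ≤
            ((P₁ * P₂ : ℕ) : ℝ) ^ (1 - δ₀)) →
      ∀ θ μ : ℝ, 1 / 2 < θ → θ < 1 → 1 - δ₀ / 3 ≤ μ → μ < 1 →
        ∃ ε₀ : ℝ, 0 < ε₀ ∧ ∃ x₀ : ℕ, ∀ x : ℕ, x₀ ≤ x → ∀ P₁ P₁' P₂ P₂' : ℕ,
          (x : ℝ) ^ θ ≤ 2 * (P₁ : ℝ) → P₁ ≤ P₁' → P₁' ≤ 2 * P₁ → P₁ ≤ P₂ → P₂ ≤ P₂' →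
            P₂' ≤ 2 * P₂ → ((P₁ * P₂ : ℕ) : ℝ) ≤ (x : ℝ) ^ (2 - μ) →
              ∀ h : ℤ, h ≠ 0 → (|h| : ℝ) ≤ ((P₁ * P₂ : ℕ) : ℝ) * (x : ℝ) ^ (ε₀ - 1) →
                ‖∑ Q ∈ (Finset.Ioc P₁ P₁').filter (fun Q : ℕ => Q.Prime ∧ Q % 4 = 1),
                    ∑ Q' ∈ (Finset.Ioc P₂ P₂').filter (fun Q' : ℕ => Q'.Prime ∧ Q' % 4 = 1),
                      (jacobiSym (Q : ℤ) Q' : ℂ) *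
                        ∑ ν ∈ (Finset.range (Q * Q')).filter (fun ν : ℕ => Q * Q' ∣ ν ^ 2 + 1),
                          Complex.exp (2 * Real.pi * Complex.I * (h : ℂ) * (ν : ℂ) /
                            ((Q * Q' : ℕ) : ℂ))‖ ≤
                  (x : ℝ) ^ (1 - ε₀) := by
  intro δ₀ hδ₀ hδ₁ hMB
  obtain ⟨P₀, hP₀⟩ := hMB
  intro θ μ hθ _hθ1 hμ _hμ1
  refine ⟨δ₀ / 3, by positivity, 4 * P₀ ^ 2 + 1, ?_⟩
  intro x hx P₁ P₁' P₂ P₂' hxP₁ h₁₁ h₁₂ h₁₃ h₂₂ h₂₃ hN h hh0 hh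
  have hx1 : (1 : ℝ) ≤ x := by exact_mod_cast (le_add_self.trans hx : 1 ≤ x)
  have hx0 : (0 : ℝ) < x := one_pos.trans_le hx1
  -- `P₀ ≤ P₁`, since `√x ≤ x^θ ≤ 2P₁` and `x > 4P₀²`
  have hP₁ : P₀ ≤ P₁ := by
    by_contra hlt
    push Not at hlt
    have h2 : (2 : ℝ) * P₁ < 2 * P₀ := by
      have : (P₁ : ℝ) + 1 ≤ P₀ := by exact_mod_cast hlt
      linarith
    have hhalf : (x : ℝ) ^ (1 / 2 : ℝ) ≤ (x : ℝ) ^ θ :=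
      Real.rpow_le_rpow_of_exponent_le hx1 hθ.le
    have hlt' : (x : ℝ) ^ (1 / 2 : ℝ) < 2 * P₀ := by linarith
    have hsq : ((x : ℝ) ^ (1 / 2 : ℝ)) ^ 2 = x := by
      rw [← Real.rpow_natCast, ← Real.rpow_mul hx0.le]; norm_num
    have hxlt : (x : ℝ) < (2 * P₀) ^ 2 := by
      rw [← hsq]
      exact pow_lt_pow_left₀ hlt' (Real.rpow_nonneg hx0.le _) two_ne_zero
    have hx' : ((4 * P₀ ^ 2 + 1 : ℕ) : ℝ) ≤ x := by exact_mod_cast hx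
    push_cast at hx'
    linarith
  set N : ℝ := ((P₁ * P₂ : ℕ) : ℝ) with hNdef
  have habs1 : (1 : ℝ) ≤ |(h : ℝ)| := by exact_mod_cast Int.one_le_abs hh0
  have hNpos : 0 < N := by
    have hN0 : 0 ≤ N := Nat.cast_nonneg _
    rcases hN0.lt_or_eq with hpos | hzero
    · exact hpos
    · exfalso
      rw [← hzero, zero_mul] at hh
      linarith
  obtain ⟨hbud, hkey⟩ := Weyl.rpow_budget hδ₀ hδ₁ hμ hx1 hNpos hN
  -- the aspect bound is automatic in the corner
  have hNreal : (P₁ : ℝ) * (P₂ : ℝ) ≤ (x : ℝ) ^ (2 - μ) := by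
    have : N = (P₁ : ℝ) * (P₂ : ℝ) := by rw [hNdef]; push_cast; ring
    rw [← this]; exact hN
  have hP1one : (1 : ℝ) ≤ (P₁ : ℝ) := by
    have h1 : (1 : ℝ) ≤ (x : ℝ) ^ θ := Real.one_le_rpow hx1 (by linarith)
    have hP1pos : (0 : ℝ) < (P₁ : ℝ) := by linarith
    exact_mod_cast (Nat.one_le_iff_ne_zero.mpr (by rintro rfl; simp at hP1pos) : 1 ≤ P₁)
  have hasp : (P₂ : ℝ) ≤ 8 * (P₁ : ℝ) ^ (1 + δ₀) :=
    Weyl.aspect_of_corner hδ₀ hδ₁ hθ hμ hx1 hP1one hxP₁ hNreal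
  exact (hP₀ P₁ P₁' P₂ P₂' hP₁ h₁₁ h₁₂ h₁₃ h₂₂ h₂₃ hasp h hh0 (hh.trans hbud)).trans hkey

end Summit.Parity.BatemanHorn.Cruxes.SplitBlockJacobi.CofactorRootDiscrepancy

end
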